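import Literature.Computability.Cryptography.HardCoreFunctionsHidingProduct
import Literature.Computability.Cryptography.LeftoverHashMinEntropy
import HarnessLib

/-!
# Pseudorandom generators from hiding randomized functions with few collisions (Goldreich 2001, §3.5.1–3.5.2)

`PseudorandomGeneratorsInjectiveOWF.lean` proves Goldreich's Thm. 3.5.6 (pseudorandom generators from 1-1
one-way functions) by the "second alternative" of §3.5.1.3: hash the direct product of many copies of the
function together with their Goldreich–Levin bits (Constructions 3.5.2 and 3.5.4), the hashed string being a
*flat* source because the function is 1-1. The same argument proves more, and §3.5.2 ("Using Regular One-Way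
Functions") uses more: it is enough that the function — in general a *randomized* function `g(x, ρ)` that is
**hiding** (no efficient algorithm recovers `x` from `g(x, ρ)`), such as `(f(x), h(x), h)` for a regular
one-way `f` (Construction 3.5.8, Prop. 3.5.9) — has **few collisions**,
`#{(v, v') : g v = g v'} ≤ 2^{c₀}·2^{|v|}` on the seeds `v = x ‖ ρ` of each level (an average preimage
size `≤ 2^{c₀}`; `c₀ = 0` for 1-1 functions, `c₀ = 1` for `(f(x), h(x), h)` with `h` hashing to
`log₂|f⁻¹(f(x))|` bits): then the hashed string has collision probability `≤ 2^{c₀ t}·2^{-t·A}` and the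
Leftover Hash Lemma in collision-probability form (`LeftoverHash.leftoverHash_collProb`,
`LeftoverHashMinEntropy.lean`) replaces the flat-source form, the `t·k` Goldreich–Levin bits
(`k = ⌊log₂ n⌋ → ∞`) paying for the `c₀·t` lost ones. This file proves

* `HidePRG.PRGExist_of_hiding`: **if an efficiently computable randomized function `g` is `S₀`-hiding
  and has few collisions, then pseudorandom generators exist**,

with the generator of `PseudorandomGeneratorsInjectiveOWF.lean` built on the samplers of
`HardCoreFunctionsHidingProduct.lean` (`Q : HCHide.Data`): `G_n(τ, w₁, …, w_t) = h_τ(body(w₁) ‖ ⋯ ‖ body(w_t)) ‖ τ`,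
`t = n + 1`, hash output length `kOut = t·aT + 1`, seed length `d = K + t·aT`, output length `d + 1`.
Contents: parameters and strings (`bb = Lp + A`, `M`, `kOut`, `K`, `d`, `r`; `BX`, `pieceY`, `BYt`/`BY`,
`out`); the collision counts (`card_collP`, `card_collT`: collisions of the ideal bodies multiply over
independent blocks); the programs (`ΨF`, `pieceB`, `tupleB`, `genF`, schedule `dU`) with values and `FP`
membership; the chain `Z`/`Out` (`sampled_append`, `map_fp`), its laws (`Out_SX_eq`, `Out_SY_eq`,
`levelEnsemble_eq`); the extraction step `tvDist_OutY_le` (collision-probability LHL) with `ratio_le`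
(`n ≥ 2^{c₀+1}`), `isStatisticallyClose_OutY`; `strictMono_d`; the theorem.

## References

* O. Goldreich, *Foundations of Cryptography I: Basic Tools*, CUP 2001 (2004 printing): §3.5.1 (Lemma
  3.5.1, Constructions 3.5.2/3.5.4, Props. 3.5.3/3.5.5, Thm. 3.5.6), §3.5.2 (Construction 3.5.8, Prop. 3.5.9,
  "Applying Proposition 3.5.9", Thm. 3.5.11) (PDF pp. 168–181).
* J. Håstad, R. Impagliazzo, L. A. Levin, M. Luby, *A pseudorandom generator from any one-way function*,
  SIAM J. Comput. 28(4) (1999), Lemma 4.8 (Leftover Hash Lemma, collision-probability/Rényi-entropy form).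
* O. Goldreich, H. Krawczyk, M. Luby, *On the existence of pseudorandom generators*, SIAM J. Comput. 22(6)
  (1993) (pseudorandom generators from regular one-way functions).
-/

namespace Literature.Computability.Cryptography

open Filter Asymptotics _root_.Computability Complexity Finset Polynomial Hybrid HCProd InjPRG

namespace HidePRG

variable (Q : HCHide.Data)

/-! ### Level parameters -/

/-- `bb n = Lp n + A n`: the (padded) common sample length. [folklore] -/
noncomputable def bb (n : ℕ) : ℕ := Q.Lp.eval n + Q.A.eval n

/-- `M n = t·bb`: the length of the hashed string. [folklore] -/
noncomputable def M (n : ℕ) : ℕ := t n * bb Q n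

/-- `kOut n = t·aT + 1`: the hash output length. [Goldreich 2001, Construction 3.5.2] [folklore] -/
noncomputable def kOut (n : ℕ) : ℕ := t n * Q.aT n + 1

/-- `K n = kOut·(M + 1)`: the key length of the affine hash. [folklore] -/
noncomputable def K (n : ℕ) : ℕ := kOut Q n * (M Q n + 1)

/-- `d n = K + t·aT`: the seed length at level `n`. [folklore] -/
noncomputable def d (n : ℕ) : ℕ := K Q n + t n * Q.aT n

/-- `r n = kOut + K`: the output length at level `n`. [folklore] -/
noncomputable def r (n : ℕ) : ℕ := kOut Q n + K Q n

/-- **The stretch is one bit**: `r n = d n + 1`. [Goldreich 2001, Construction 3.5.2] [folklore] -/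
theorem r_eq (n : ℕ) : r Q n = d Q n + 1 := by unfold r d kOut; ring

/-- `n0 n = n + r0 n`: the seed length of `g`. [folklore] -/
def n0 (n : ℕ) : ℕ := n + Q.r0 n

variable {Q}

/-- `b n = bb n` for good data. [folklore] -/
theorem b_eq (hQ : Q.Good) (n : ℕ) : Q.b n = bb Q n := by
  have h1 := hQ.2.2 n
  have h2 : n + Q.r0 n ≤ Q.A.eval n := (Q.le_cR n).trans ((Q.cR_le_aT n).trans (Q.aT_le_A n))
  unfold HCHide.Data.b HCHide.Data.padLen bb
  omega

/-- `n0 n ≤ A n`. [folklore] -/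
theorem n0_le_A (n : ℕ) : n0 Q n ≤ Q.A.eval n := (Q.le_cR n).trans ((Q.cR_le_aT n).trans (Q.aT_le_A n))

/-! ### The strings -/

variable (Q)

/-- **The real bodies** on the tight coins (`t` blocks of `aT n` bits). [Goldreich 2001, Construction 3.5.4] [folklore] -/
noncomputable def BX (n : ℕ) (R : List Bool) : List Bool :=
  ((List.range (t n)).map fun i => Q.body n (blk (Q.aT n) i R)).flatten

/-- **One ideal piece** on a block `w` of `A n` coins: `g(w ↾ n0) ‖ w ⇂ n0 ‖ 0^{padLen}`. [folklore] -/
noncomputable def pieceY (n : ℕ) (w : List Bool) : List Bool :=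
  Q.g (w.take (n0 Q n)) ++ w.drop (n0 Q n) ++ List.replicate (Q.padLen n) false

/-- **The ideal bodies** with `T` blocks. [folklore] -/
noncomputable def BYt (n T : ℕ) (R : List Bool) : List Bool :=
  ((List.range T).map fun i => pieceY Q n (blk (Q.A.eval n) i R)).flatten

/-- **The ideal bodies** (`t n` blocks). [Goldreich 2001, Prop. 3.5.5 (the `0`th hybrid)] [folklore] -/
noncomputable def BY (n : ℕ) (R : List Bool) : List Bool := BYt Q n (t n) R

/-- **The output** on a key `τ` and a hashed string `B`: `h_τ(B) ‖ τ`. [Goldreich 2001, Construction 3.5.2] [folklore] -/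
noncomputable def out (n : ℕ) (τ B : List Bool) : List Bool := AffineStr.hashStr (M Q n) (kOut Q n) τ B ++ τ

variable {Q}

/-- `|out n τ B| = kOut + |τ|`. [folklore] -/
theorem length_out (n : ℕ) (τ B : List Bool) : (out Q n τ B).length = kOut Q n + τ.length := by
  rw [out, List.length_append, AffineStr.length_hashStr]

/-- `|BX n R| = M n` for `|R| = t·aT`. [folklore] -/
theorem length_BX (hQ : Q.Good) {n : ℕ} {R : List Bool} (hR : R.length = t n * Q.aT n) : (BX Q n R).length = M Q n := by
  unfold BX M
  rw [← b_eq hQ]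
  exact length_flatten_map_range fun i hi => Q.length_body hQ (length_blk_of_le (by rw [hR]; exact Nat.mul_le_mul_right _ hi))

/-- An ideal piece has length `bb n` on a block of `A n` coins. [folklore] -/
theorem length_pieceY (hQ : Q.Good) {n : ℕ} {w : List Bool} (hw : w.length = Q.A.eval n) : (pieceY Q n w).length = bb Q n := by
  have hx : (w.take (n0 Q n)).length = n + Q.r0 n := by rw [List.length_take, hw, min_eq_left (n0_le_A n)]; rfl
  rw [pieceY, List.length_append, List.length_append, hQ.2.1 n _ hx, List.length_drop, hw, List.length_replicate, ← b_eq hQ,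
    HCHide.Data.b, n0]

/-- `|BYt n T R| = T·bb n` for `|R| = T·A`. [folklore] -/
theorem length_BYt (hQ : Q.Good) {n T : ℕ} {R : List Bool} (hR : R.length = T * Q.A.eval n) : (BYt Q n T R).length = T * bb Q n :=
  length_flatten_map_range fun i hi => length_pieceY hQ (length_blk_of_le (by rw [hR]; exact Nat.mul_le_mul_right _ hi))

/-- `|BY n R| = M n` for `|R| = t·A`. [folklore] -/
theorem length_BY (hQ : Q.Good) {n : ℕ} {R : List Bool} (hR : R.length = t n * Q.A.eval n) : (BY Q n R).length = M Q n :=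
  length_BYt hQ hR

/-! ### Collisions of the ideal bodies -/

section Collisions

variable (Q)

/-- **The collision bound** (few collisions of `g` on the seeds of each level): `#{(v, v') : g v = g v'} ≤ 2^{c₀}·2^{n0}`
over `v, v' ∈ {0,1}^{n0 n}` — an average preimage size of at most `2^{c₀}`. [Goldreich 2001, §3.5.2 (almost 1-1
functions); HILL 1999, §4 (Rényi entropy)] [folklore] -/
def CollBound (c0 : ℕ) : Prop :=
  ∀ n, (((allStr (n0 Q n)) ×ˢ (allStr (n0 Q n))).filter fun q => Q.g q.1 = Q.g q.2).card ≤ 2 ^ c0 * 2 ^ n0 Q n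

/-- The collisions of `g` at level `n`. [folklore] -/
noncomputable def collG (n : ℕ) : Finset (List Bool × List Bool) :=
  ((allStr (n0 Q n)) ×ˢ (allStr (n0 Q n))).filter fun q => Q.g q.1 = Q.g q.2

/-- The collisions of one ideal piece. [folklore] -/
noncomputable def collP (n : ℕ) : Finset (List Bool × List Bool) :=
  ((allStr (Q.A.eval n)) ×ˢ (allStr (Q.A.eval n))).filter fun q => pieceY Q n q.1 = pieceY Q n q.2

/-- The collisions of the ideal bodies with `T` blocks. [folklore] -/
noncomputable def collT (n T : ℕ) : Finset (List Bool × List Bool) :=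
  ((allStr (T * Q.A.eval n)) ×ˢ (allStr (T * Q.A.eval n))).filter fun q => BYt Q n T q.1 = BYt Q n T q.2

variable {Q}

/-- Two ideal pieces on full blocks agree iff the `g`-parts and the pass-through parts agree. [folklore] -/
theorem pieceY_eq_iff (hQ : Q.Good) {n : ℕ} {w w' : List Bool} (hw : w.length = Q.A.eval n) (hw' : w'.length = Q.A.eval n) :
    pieceY Q n w = pieceY Q n w' ↔ Q.g (w.take (n0 Q n)) = Q.g (w'.take (n0 Q n)) ∧ w.drop (n0 Q n) = w'.drop (n0 Q n) := by
  have hx : (w.take (n0 Q n)).length = n + Q.r0 n := by rw [List.length_take, hw, min_eq_left (n0_le_A n)]; rfl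
  have hx' : (w'.take (n0 Q n)).length = n + Q.r0 n := by rw [List.length_take, hw', min_eq_left (n0_le_A n)]; rfl
  unfold pieceY
  constructor
  · intro h
    have h' := List.append_cancel_right h
    exact List.append_inj h' (by rw [hQ.2.1 n _ hx, hQ.2.1 n _ hx'])
  · rintro ⟨h1, h2⟩
    rw [h1, h2]

/-- **Collisions of one ideal piece**: `#collP = #collG · 2^{A − n0}` (the pass-through part must coincide).
[folklore] -/
theorem card_collP (hQ : Q.Good) (n : ℕ) : (collP Q n).card = (collG Q n).card * 2 ^ (Q.A.eval n - n0 Q n) := by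
  classical
  have hn0 := n0_le_A (Q := Q) n
  -- the map `(w, w') ↦ ((w ↾ n0, w' ↾ n0), w ⇂ n0)` is a bijection `collP → collG × allStr (A − n0)`
  have himage : (collP Q n).image (fun q : List Bool × List Bool => ((q.1.take (n0 Q n), q.2.take (n0 Q n)), q.1.drop (n0 Q n))) =
      (collG Q n) ×ˢ allStr (Q.A.eval n - n0 Q n) := by
    ext ⟨⟨u, u'⟩, v⟩
    simp only [Finset.mem_image, Finset.mem_product, collP, collG, Finset.mem_filter, mem_allStr, Prod.mk.injEq, Prod.exists]
    constructor
    · rintro ⟨w, w', ⟨⟨hw, hw'⟩, heq⟩, ⟨rfl, rfl⟩, rfl⟩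
      obtain ⟨hg, _⟩ := (pieceY_eq_iff hQ hw hw').1 heq
      refine ⟨⟨⟨?_, ?_⟩, hg⟩, ?_⟩
      · rw [List.length_take, hw, min_eq_left hn0]
      · rw [List.length_take, hw', min_eq_left hn0]
      · rw [List.length_drop, hw]
    · rintro ⟨⟨⟨hu, hu'⟩, hg⟩, hv⟩
      refine ⟨u ++ v, u' ++ v, ⟨⟨by rw [List.length_append, hu, hv]; omega, by rw [List.length_append, hu', hv]; omega⟩, ?_⟩, ?_, ?_⟩
      · rw [pieceY_eq_iff hQ (by rw [List.length_append, hu, hv]; omega) (by rw [List.length_append, hu', hv]; omega),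
          List.take_left' hu, List.take_left' hu', List.drop_left' hu, List.drop_left' hu']
        exact ⟨hg, rfl⟩
      · exact ⟨List.take_left' hu, List.take_left' hu'⟩
      · exact List.drop_left' hu
  have hinj : Set.InjOn (fun q : List Bool × List Bool => ((q.1.take (n0 Q n), q.2.take (n0 Q n)), q.1.drop (n0 Q n))) (collP Q n) := by
    rintro ⟨w, w'⟩ hq ⟨z, z'⟩ hz h
    simp only [collP, Finset.coe_filter, Set.mem_setOf_eq, Finset.mem_product, mem_allStr] at hq hz
    simp only [Prod.mk.injEq] at h
    obtain ⟨⟨h1, h2⟩, h3⟩ := h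
    have hd : w'.drop (n0 Q n) = w.drop (n0 Q n) := ((pieceY_eq_iff hQ hq.1.1 hq.1.2).1 hq.2).2.symm
    have hd' : z'.drop (n0 Q n) = z.drop (n0 Q n) := ((pieceY_eq_iff hQ hz.1.1 hz.1.2).1 hz.2).2.symm
    refine Prod.ext ?_ ?_
    · rw [← List.take_append_drop (n0 Q n) w, ← List.take_append_drop (n0 Q n) z, h1, h3]
    · show w' = z'
      rw [← List.take_append_drop (n0 Q n) w', ← List.take_append_drop (n0 Q n) z', h2, hd, hd', h3]
  rw [← Finset.card_image_of_injOn hinj, himage, Finset.card_product, card_allStr]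

/-- `BYt` with one more block, on a concatenation. [folklore] -/
theorem BYt_succ_append {n T : ℕ} {w : List Bool} (hw : w.length = Q.A.eval n) (R : List Bool) :
    BYt Q n (T + 1) (w ++ R) = pieceY Q n w ++ BYt Q n T R := by
  unfold BYt
  rw [List.range_succ_eq_map, List.map_cons, List.map_map, List.flatten_cons, PRGRep.blk_zero_append hw]
  congr 1
  refine congrArg List.flatten (List.map_congr_left fun i _ => ?_)
  rw [Function.comp_apply, PRGRep.blk_succ_append hw]

/-- **Collisions of the ideal bodies multiply over the blocks**: `#collT (T) = (#collP)^T`. [folklore] -/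
theorem card_collT (hQ : Q.Good) (n : ℕ) : ∀ T : ℕ, (collT Q n T).card = (collP Q n).card ^ T
  | 0 => by
    unfold collT
    rw [pow_zero, zero_mul, Finset.card_eq_one]
    refine ⟨([], []), ?_⟩
    ext ⟨R, R'⟩
    simp only [Finset.mem_filter, Finset.mem_product, mem_allStr, List.length_eq_zero_iff, Finset.mem_singleton, Prod.mk.injEq]
    constructor
    · rintro ⟨⟨rfl, rfl⟩, _⟩; exact ⟨rfl, rfl⟩
    · rintro ⟨rfl, rfl⟩; exact ⟨⟨rfl, rfl⟩, rfl⟩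
  | T + 1 => by
    classical
    have ih := card_collT hQ n T
    -- split `(R, R')` with `R = w ++ S`, `R' = w' ++ S'`
    have himage : (collT Q n (T + 1)).image (fun q : List Bool × List Bool => ((q.1.take (Q.A.eval n), q.2.take (Q.A.eval n)), (q.1.drop (Q.A.eval n), q.2.drop (Q.A.eval n)))) =
        (collP Q n) ×ˢ (collT Q n T) := by
      ext ⟨⟨w, w'⟩, ⟨S, S'⟩⟩
      simp only [Finset.mem_image, Finset.mem_product, collT, collP, Finset.mem_filter, mem_allStr, Prod.mk.injEq, Prod.exists]
      constructor
      · rintro ⟨R, R', ⟨⟨hR, hR'⟩, heq⟩, ⟨rfl, rfl⟩, rfl, rfl⟩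
        have hw : (R.take (Q.A.eval n)).length = Q.A.eval n := by rw [List.length_take, hR, Nat.succ_mul]; exact min_eq_left (by omega)
        have hw' : (R'.take (Q.A.eval n)).length = Q.A.eval n := by rw [List.length_take, hR', Nat.succ_mul]; exact min_eq_left (by omega)
        have hS : (R.drop (Q.A.eval n)).length = T * Q.A.eval n := by rw [List.length_drop, hR, Nat.succ_mul]; omega
        have hS' : (R'.drop (Q.A.eval n)).length = T * Q.A.eval n := by rw [List.length_drop, hR', Nat.succ_mul]; omega
        rw [← List.take_append_drop (Q.A.eval n) R, ← List.take_append_drop (Q.A.eval n) R', BYt_succ_append hw, BYt_succ_append hw'] at heq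
        obtain ⟨h1, h2⟩ := List.append_inj heq (by rw [length_pieceY hQ hw, length_pieceY hQ hw'])
        exact ⟨⟨⟨hw, hw'⟩, h1⟩, ⟨hS, hS'⟩, h2⟩
      · rintro ⟨⟨⟨hw, hw'⟩, h1⟩, ⟨hS, hS'⟩, h2⟩
        refine ⟨w ++ S, w' ++ S', ⟨⟨by rw [List.length_append, hw, hS, Nat.succ_mul]; omega,
          by rw [List.length_append, hw', hS', Nat.succ_mul]; omega⟩, ?_⟩, ?_, ?_, ?_⟩
        · rw [BYt_succ_append hw, BYt_succ_append hw', h1, h2]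
        · exact ⟨List.take_left' hw, List.take_left' hw'⟩
        · exact List.drop_left' hw
        · exact List.drop_left' hw'
    have hinj : Set.InjOn (fun q : List Bool × List Bool => ((q.1.take (Q.A.eval n), q.2.take (Q.A.eval n)), (q.1.drop (Q.A.eval n), q.2.drop (Q.A.eval n)))) (collT Q n (T + 1)) := by
      rintro ⟨R, R'⟩ _ ⟨Z, Z'⟩ _ h
      simp only [Prod.mk.injEq] at h
      obtain ⟨⟨h1, h2⟩, h3, h4⟩ := h
      refine Prod.ext ?_ ?_
      · show R = Z
        rw [← List.take_append_drop (Q.A.eval n) R, ← List.take_append_drop (Q.A.eval n) Z, h1, h3]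
      · show R' = Z'
        rw [← List.take_append_drop (Q.A.eval n) R', ← List.take_append_drop (Q.A.eval n) Z', h2, h4]
    rw [← Finset.card_image_of_injOn hinj, himage, Finset.card_product, ih, pow_succ, Nat.mul_comm]

/-- **The collision count of the ideal bodies**: `#collT (t) ≤ (2^{c₀})^t · 2^{t·A}` under the collision
bound. [folklore] -/
theorem card_collT_le (hQ : Q.Good) {c0 : ℕ} (hcoll : CollBound Q c0) (n T : ℕ) :
    (collT Q n T).card ≤ (2 ^ c0) ^ T * 2 ^ (T * Q.A.eval n) := by
  have hn0 := n0_le_A (Q := Q) n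
  rw [card_collT hQ, card_collP hQ, pow_mul', ← mul_pow]
  refine Nat.pow_le_pow_left ?_ T
  calc (collG Q n).card * 2 ^ (Q.A.eval n - n0 Q n) ≤ 2 ^ c0 * 2 ^ n0 Q n * 2 ^ (Q.A.eval n - n0 Q n) :=
        Nat.mul_le_mul_right _ (hcoll n)
    _ = 2 ^ c0 * 2 ^ Q.A.eval n := by rw [mul_assoc, ← pow_add, Nat.add_sub_cancel' hn0]

end Collisions

/-! ### Programs: the schedule, the post-processing and the generator -/

section Program

open Complexity.Brick Complexity.Plumb Complexity.OracleCompose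

variable (Q)

/-- `1^{bb n}`. [folklore] -/
noncomputable def bbU : List Bool → List Bool := concatFn ∘ fanoutFn (polyFn Q.Lp ∘ fstF) Q.aU
/-- `1^{M n}`. [folklore] -/
noncomputable def MU : List Bool → List Bool := HashBricks.umulFn ∘ fanoutFn tU (bbU Q)
/-- `1^{t·aT}`. [folklore] -/
noncomputable def taU : List Bool → List Bool := HashBricks.umulFn ∘ fanoutFn tU Q.aTU
/-- `1^{kOut n}`. [folklore] -/
noncomputable def kOutU : List Bool → List Bool := List.cons true ∘ taU Q
/-- `1^{K n}`. [folklore] -/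
noncomputable def KU : List Bool → List Bool := HashBricks.umulFn ∘ fanoutFn (kOutU Q) (List.cons true ∘ MU Q)
/-- `1^{d n}`. [folklore] -/
noncomputable def dU : List Bool → List Bool := concatFn ∘ fanoutFn (KU Q) (taU Q)
/-- The key `τ = w ↾ K`. [folklore] -/
noncomputable def τF : List Bool → List Bool := takeFn ∘ fanoutFn (KU Q) sndF
/-- The rest `w ⇂ K`. [folklore] -/
noncomputable def ρF : List Bool → List Bool := dropFn ∘ fanoutFn (KU Q) sndF
/-- The hash `h_τ(w ⇂ K)` by `AffineProg.hashFn`. [folklore] -/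
noncomputable def hashF : List Bool → List Bool := AffineProg.hashFn ∘ fanoutFn (fanoutFn (MU Q) (kOutU Q)) (fanoutFn (τF Q) (ρF Q))
/-- **The post-processing** `Ψ⟨u, w⟩ = h_{w ↾ K}(w ⇂ K) ‖ w ↾ K`. [Goldreich 2001, Construction 3.5.2] [folklore] -/
noncomputable def ΨF : List Bool → List Bool := concatFn ∘ fanoutFn (hashF Q) (τF Q)
/-- The piece of the fold: on `⟨⟨u, R⟩, 1ʲ⟩`, `S_X⟨u, block j of R⟩` (blocks of `aT |u|` bits). [folklore] -/
noncomputable def pieceB : List Bool → List Bool :=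
  Q.SX ∘ fanoutFn (fstF ∘ fstF) (takeFn ∘ fanoutFn (Q.aTU ∘ fstF)
    (dropFn ∘ fanoutFn (HashBricks.umulFn ∘ fanoutFn sndF (Q.aTU ∘ fstF)) (sndF ∘ fstF)))
/-- **The bodies** `⟨u, R⟩ ↦ body(block 0) ‖ ⋯ ‖ body(block t−1)` as a clipped concatenation fold. [folklore] -/
noncomputable def tupleB : List Bool → List Bool :=
  sndPow 2 ∘ foldLoop appF (clipF 2 (pieceB Q)) X ∘ fanoutFn id (fanoutFn (lenBinF ∘ tU) (fun _ => boolPair [] []))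
/-- **The generator** `G⟨u, s⟩ = Ψ⟨u, (s ↾ K) ‖ bodies(s ⇂ K)⟩`. [Goldreich 2001, Construction 3.5.2 with 3.5.4 / 3.5.8]
[cite: Goldreich2001, Construction 3.5.2 with Construction 3.5.4 (PDF pp. 170, 173)] -/
noncomputable def genF : List Bool → List Bool :=
  ΨF Q ∘ fanoutFn fstF (concatFn ∘ fanoutFn (τF Q) (tupleB Q ∘ fanoutFn fstF (ρF Q)))
/-- The schedule `u ↦ 1^{d |u|}` as a pipeline. [folklore] -/
noncomputable def dFF : List Bool → List Bool := dU Q ∘ fanoutFn id (fun _ => [])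

variable {Q}

/-- `ones a ++ ones b = ones (a + b)`. [folklore] -/
private theorem ones_append (a c : ℕ) : ones a ++ ones c = ones (a + c) := by
  simp [ones, List.replicate_append_replicate]

/-- `|1ⁿ| = n`. [folklore] -/
private theorem length_unaryEncodeNat (n : ℕ) : (unaryEncodeNat n).length = n := unary_decode_encode_nat n

/-- Values of the unary helpers on `⟨u, s⟩`. [folklore] -/
theorem units2_boolPair (u s : List Bool) :
    tU (boolPair u s) = ones (t u.length) ∧ bbU Q (boolPair u s) = ones (bb Q u.length) ∧
      MU Q (boolPair u s) = ones (M Q u.length) ∧ taU Q (boolPair u s) = ones (t u.length * Q.aT u.length) ∧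
      kOutU Q (boolPair u s) = ones (kOut Q u.length) ∧ KU Q (boolPair u s) = ones (K Q u.length) ∧
      dU Q (boolPair u s) = ones (d Q u.length) := by
  have ht : tU (boolPair u s) = ones (t u.length) := (InjPRG.units2_boolPair (p := 0) u s).1
  obtain ⟨ha, _, _, _, _, haT⟩ := HCHide.Data.units_boolPair (Q := Q) u s
  have hb : bbU Q (boolPair u s) = ones (bb Q u.length) := by
    rw [bbU, Function.comp_apply, fanoutFn_apply, Function.comp_apply, fstF_boolPair, polyFn_apply, ha, concatFn_boolPair,
      ones_append]; rfl
  have hM : MU Q (boolPair u s) = ones (M Q u.length) := by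
    rw [MU, Function.comp_apply, fanoutFn_apply, ht, hb, HashBricks.umulFn_apply, fstF_boolPair, sndF_boolPair,
      List.length_replicate, List.length_replicate]; rfl
  have hta : taU Q (boolPair u s) = ones (t u.length * Q.aT u.length) := by
    rw [taU, Function.comp_apply, fanoutFn_apply, ht, haT, HashBricks.umulFn_apply, fstF_boolPair, sndF_boolPair,
      List.length_replicate, List.length_replicate]
  have hko : kOutU Q (boolPair u s) = ones (kOut Q u.length) := by rw [kOutU, Function.comp_apply, hta]; rfl
  have hK : KU Q (boolPair u s) = ones (K Q u.length) := by
    rw [KU, Function.comp_apply, fanoutFn_apply, hko, Function.comp_apply, hM, HashBricks.umulFn_apply, fstF_boolPair,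
      sndF_boolPair, List.length_replicate, List.length_cons, List.length_replicate]; rfl
  have hd : dU Q (boolPair u s) = ones (d Q u.length) := by
    rw [dU, Function.comp_apply, fanoutFn_apply, hK, hta, concatFn_boolPair, ones_append]; rfl
  exact ⟨ht, hb, hM, hta, hko, hK, hd⟩

/-- Value of `τF`. [folklore] -/
theorem τF_boolPair (u w : List Bool) : τF Q (boolPair u w) = w.take (K Q u.length) := by
  obtain ⟨_, _, _, _, _, hK, _⟩ := units2_boolPair (Q := Q) u w
  rw [τF, Function.comp_apply, fanoutFn_apply, hK, sndF_boolPair, takeFn_boolPair, List.length_replicate]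

/-- Value of `ρF`. [folklore] -/
theorem ρF_boolPair (u w : List Bool) : ρF Q (boolPair u w) = w.drop (K Q u.length) := by
  obtain ⟨_, _, _, _, _, hK, _⟩ := units2_boolPair (Q := Q) u w
  rw [ρF, Function.comp_apply, fanoutFn_apply, hK, sndF_boolPair, dropFn_boolPair, List.length_replicate]

/-- **Value of the post-processing**: `Ψ⟨u, w⟩ = out |u| (w ↾ K) (w ⇂ K)`. [folklore] -/
theorem ΨF_boolPair (u w : List Bool) :
    ΨF Q (boolPair u w) = out Q u.length (w.take (K Q u.length)) (w.drop (K Q u.length)) := by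
  obtain ⟨_, _, hM, _, hko, _, _⟩ := units2_boolPair (Q := Q) u w
  rw [ΨF, Function.comp_apply, fanoutFn_apply, hashF, Function.comp_apply, fanoutFn_apply, fanoutFn_apply, fanoutFn_apply,
    hM, hko, τF_boolPair, ρF_boolPair, AffineProg.hashFn_boolPair, concatFn_boolPair, out]

/-- **Value of a piece** on a full block: `body n (block j of R)`. [folklore] -/
theorem pieceB_apply (hQ : Q.Good) {n : ℕ} {R : List Bool} {j : ℕ} (hj : (j + 1) * Q.aT n ≤ R.length) :
    pieceB Q (boolPair (boolPair (unaryEncodeNat n) R) (ones j)) = Q.body n (blk (Q.aT n) j R) := by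
  have hun : (unaryEncodeNat n).length = n := length_unaryEncodeNat n
  obtain ⟨_, _, _, _, _, haT⟩ := HCHide.Data.units_boolPair (Q := Q) (unaryEncodeNat n) R
  rw [hun] at haT
  have hblk : (blk (Q.aT n) j R).length = Q.aT n := length_blk_of_le hj
  have h1 : (fanoutFn (fstF ∘ fstF) (takeFn ∘ fanoutFn (Q.aTU ∘ fstF)
      (dropFn ∘ fanoutFn (HashBricks.umulFn ∘ fanoutFn sndF (Q.aTU ∘ fstF)) (sndF ∘ fstF))))
        (boolPair (boolPair (unaryEncodeNat n) R) (ones j)) = boolPair (unaryEncodeNat n) (blk (Q.aT n) j R) := by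
    simp only [Function.comp_apply, fanoutFn_apply, fstF_boolPair, sndF_boolPair, haT, HashBricks.umulFn_apply,
      List.length_replicate, dropFn_boolPair, takeFn_boolPair, blk]
  rw [pieceB, Function.comp_apply, h1, HCHide.Data.SX_boolPair hQ n (by rw [hblk]), List.take_of_length_le hblk.le]

/-- **A body fits twice in the fold input** (`bb n ≤ 2(2n + 3 + t·aT)`, as `aT ≥ Lp n` and `aT + n ≥ A n`). [folklore] -/
theorem bb_le_clip (n : ℕ) : bb Q n ≤ 2 * (2 * n + 2 + t n * Q.aT n + 1) := by
  have hk := kL_le n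
  have hLp := Q.Lp_le_aT n
  have hkA : kL n ≤ Q.A.eval n := by rw [HCHide.Data.A_eval]; nlinarith
  have haT : Q.aT n + kL n = Q.A.eval n := by rw [HCHide.Data.aT, Nat.sub_add_cancel hkA]
  have hT : Q.aT n ≤ t n * Q.aT n := Nat.le_mul_of_pos_left _ (by unfold t; omega)
  unfold bb
  omega

/-- **Value of the bodies fold** on genuine inputs: `tupleB ⟨1ⁿ, R⟩ = BX n R` for `|R| = t·aT`. [folklore] -/
theorem tupleB_apply (hQ : Q.Good) {n : ℕ} {R : List Bool} (hR : R.length = t n * Q.aT n) :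
    tupleB Q (boolPair (unaryEncodeNat n) R) = BX Q n R := by
  set u := unaryEncodeNat n with hu
  have hun : u.length = n := length_unaryEncodeNat n
  obtain ⟨ht, _, _, _, _, _, _⟩ := units2_boolPair (Q := Q) u R
  have hinit : fanoutFn id (fanoutFn (lenBinF ∘ tU) (fun _ => boolPair [] [])) (boolPair u R) =
      boolPair (boolPair u R) (boolPair (encodeNat (t n)) (boolPair (ones 0) [])) := by
    rw [fanoutFn_apply, fanoutFn_apply, id, Function.comp_apply, ht, lenBinF_apply, List.length_replicate, hun]
    rfl
  have hkM : t n ≤ (X : Polynomial ℕ).eval (boolPair u R).length := by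
    rw [eval_X, length_boolPair, hun]; unfold t; omega
  have hfull : ∀ j, j < t n → (j + 1) * Q.aT n ≤ R.length := fun j hj => by rw [hR]; exact Nat.mul_le_mul_right _ hj
  have hpieces : ∀ j, j < t n → (pieceB Q (boolPair (boolPair u R) (ones j))).length ≤ 2 * ((boolPair u R).length + 1) := by
    intro j hj
    rw [hu, pieceB_apply hQ (hfull j hj), Q.length_body hQ (length_blk_of_le (hfull j hj)), b_eq hQ, length_boolPair, hun, hR]
    exact bb_le_clip n
  have hclip : foldAcc appF (clipF 2 (pieceB Q)) (boolPair u R) 0 (t n) [] = foldAcc appF (pieceB Q) (boolPair u R) 0 (t n) [] :=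
    foldAcc_clipF (fun j _ hj => hpieces j (by omega))
  have hmap : ((List.range (t n)).map fun j => pieceB Q (boolPair (boolPair u R) (ones (0 + j)))) =
      (List.range (t n)).map fun i => Q.body n (blk (Q.aT n) i R) :=
    List.map_congr_left fun j hj => by rw [zero_add, hu, pieceB_apply hQ (hfull j (List.mem_range.1 hj))]
  rw [tupleB, Function.comp_apply, Function.comp_apply, hinit, foldLoop_apply _ _ hkM 0,
    sndPow_succ_boolPair, sndPow_succ_boolPair, sndPow_zero_boolPair, hclip, foldAcc_appF, List.nil_append,
    ccat_eq_flatten_range, hmap, BX]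

/-- **Value of the generator** on a seed of length `d n`: `out n (s ↾ K) (BX n (s ⇂ K))`. [folklore] -/
theorem genF_apply (hQ : Q.Good) {n : ℕ} {s : List Bool} (hs : s.length = d Q n) :
    genF Q (boolPair (unaryEncodeNat n) s) = out Q n (s.take (K Q n)) (BX Q n (s.drop (K Q n))) := by
  have hn := length_unaryEncodeNat n
  have hK : (s.take (K Q n)).length = K Q n := by rw [List.length_take, hs, d, min_eq_left (Nat.le_add_right _ _)]
  have hR : (s.drop (K Q n)).length = t n * Q.aT n := by rw [List.length_drop, hs, d, Nat.add_sub_cancel_left]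
  rw [genF, Function.comp_apply, fanoutFn_apply, fstF_boolPair, Function.comp_apply, fanoutFn_apply, τF_boolPair, hn,
    Function.comp_apply, fanoutFn_apply, fstF_boolPair, ρF_boolPair, hn, tupleB_apply hQ hR, concatFn_boolPair,
    ΨF_boolPair, hn, List.take_left' hK, List.drop_left' hK]

/-- **Output length of the generator**: `r n` on seeds of length `d n`. [folklore] -/
theorem length_genF (hQ : Q.Good) {n : ℕ} {s : List Bool} (hs : s.length = d Q n) :
    (genF Q (boolPair (unaryEncodeNat n) s)).length = r Q n := by
  rw [genF_apply hQ hs, length_out, List.length_take, hs, d, min_eq_left (Nat.le_add_right _ _), r]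

/-- **The schedule pipeline is `PRGExt.dF (d Q)`.** [folklore] -/
theorem dFF_eq : dFF Q = PRGExt.dF (d Q) := by
  funext u
  obtain ⟨_, _, _, _, _, _, hd⟩ := units2_boolPair (Q := Q) u []
  rw [dFF, Function.comp_apply, fanoutFn_apply, id, hd]
  rfl

/-- `|Ψ⟨1ⁿ, w⟩| = r n` for `|w| ≥ K n`. [folklore] -/
theorem length_ΨF {n : ℕ} {w : List Bool} (hw : K Q n ≤ w.length) : (ΨF Q (boolPair (unaryEncodeNat n) w)).length = r Q n := by
  rw [ΨF_boolPair, length_unaryEncodeNat, length_out, List.length_take, min_eq_left hw, r]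

/-! #### `FP` membership -/

/-- The unary helpers are in `FP`. [folklore] -/
theorem units2_mem_FP : tU ∈ FP ∧ bbU Q ∈ FP ∧ MU Q ∈ FP ∧ taU Q ∈ FP ∧ kOutU Q ∈ FP ∧ KU Q ∈ FP ∧ dU Q ∈ FP := by
  have ht : tU ∈ FP := (InjPRG.units2_mem_FP (p := 0)).1
  obtain ⟨ha, _, _, _, _, haT⟩ := HCHide.Data.units_mem_FP (Q := Q)
  have hb : bbU Q ∈ FP := comp_mem_FP concatFn_mem_FP (fanoutFn_mem_FP (comp_mem_FP (polyFn_mem_FP _) fstF_mem_FP) ha)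
  have hM : MU Q ∈ FP := comp_mem_FP HashBricks.umulFn_mem_FP (fanoutFn_mem_FP ht hb)
  have hta : taU Q ∈ FP := comp_mem_FP HashBricks.umulFn_mem_FP (fanoutFn_mem_FP ht haT)
  have hko : kOutU Q ∈ FP := comp_mem_FP (cons_mem_FP true) hta
  have hK : KU Q ∈ FP := comp_mem_FP HashBricks.umulFn_mem_FP (fanoutFn_mem_FP hko (comp_mem_FP (cons_mem_FP true) hM))
  have hd : dU Q ∈ FP := comp_mem_FP concatFn_mem_FP (fanoutFn_mem_FP hK hta)
  exact ⟨ht, hb, hM, hta, hko, hK, hd⟩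

/-- `τF ∈ FP`. [folklore] -/
theorem τF_mem_FP : τF Q ∈ FP :=
  comp_mem_FP takeFn_mem_FP (fanoutFn_mem_FP (units2_mem_FP (Q := Q)).2.2.2.2.2.1 sndF_mem_FP)

/-- `ρF ∈ FP`. [folklore] -/
theorem ρF_mem_FP : ρF Q ∈ FP :=
  comp_mem_FP dropFn_mem_FP (fanoutFn_mem_FP (units2_mem_FP (Q := Q)).2.2.2.2.2.1 sndF_mem_FP)

/-- **`Ψ ∈ FP`.** [folklore] -/
theorem ΨF_mem_FP : ΨF Q ∈ FP := by
  obtain ⟨_, _, hM, _, hko, _, _⟩ := units2_mem_FP (Q := Q)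
  have hh : hashF Q ∈ FP := comp_mem_FP AffineProg.hashFn_mem_FP (fanoutFn_mem_FP (fanoutFn_mem_FP hM hko)
    (fanoutFn_mem_FP τF_mem_FP ρF_mem_FP))
  exact comp_mem_FP concatFn_mem_FP (fanoutFn_mem_FP hh τF_mem_FP)

/-- `pieceB ∈ FP` for `G2 ∈ FP`. [folklore] -/
theorem pieceB_mem_FP (hG : Q.G2 ∈ FP) : pieceB Q ∈ FP := by
  obtain ⟨_, _, _, _, _, haT⟩ := HCHide.Data.units_mem_FP (Q := Q)
  have hU : fstF ∘ fstF ∈ FP := comp_mem_FP fstF_mem_FP fstF_mem_FP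
  have hS : Q.aTU ∘ fstF ∈ FP := comp_mem_FP haT fstF_mem_FP
  exact comp_mem_FP (HCHide.Data.SX_mem_FP hG) (fanoutFn_mem_FP hU (comp_mem_FP takeFn_mem_FP (fanoutFn_mem_FP hS
    (comp_mem_FP dropFn_mem_FP (fanoutFn_mem_FP (comp_mem_FP HashBricks.umulFn_mem_FP (fanoutFn_mem_FP sndF_mem_FP hS))
      (comp_mem_FP sndF_mem_FP fstF_mem_FP))))))

/-- **The bodies fold is in `FP`.** [Arora–Barak 2009, §1.3, §1.4.1] [folklore] -/
theorem tupleB_mem_FP (hG : Q.G2 ∈ FP) : tupleB Q ∈ FP :=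
  comp_mem_FP (sndPow_mem_FP 2) (comp_mem_FP
    (foldLoop_clipF_mem_FP 2 appF_mem_FP length_appF_le (pieceB_mem_FP hG) X)
    (fanoutFn_mem_FP (PolyTimeComputable.id _)
      (fanoutFn_mem_FP (comp_mem_FP lenBinF_mem_FP (units2_mem_FP (Q := Q)).1) (const_mem_FP _))))

/-- **The generator is polynomial time.** [Goldreich 2001, Construction 3.5.2] [folklore] -/
theorem genF_mem_FP (hG : Q.G2 ∈ FP) : genF Q ∈ FP :=
  comp_mem_FP ΨF_mem_FP (fanoutFn_mem_FP fstF_mem_FP (comp_mem_FP concatFn_mem_FP (fanoutFn_mem_FP τF_mem_FP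
    (comp_mem_FP (tupleB_mem_FP hG) (fanoutFn_mem_FP fstF_mem_FP ρF_mem_FP)))))

/-- **The schedule is computable in unary in polynomial time.** [folklore] -/
theorem dF_mem_FP : PRGExt.dF (d Q) ∈ FP := by
  rw [← dFF_eq]
  exact comp_mem_FP (units2_mem_FP (Q := Q)).2.2.2.2.2.2 (fanoutFn_mem_FP (PolyTimeComputable.id _) (const_mem_FP _))

end Program

/-! ### The chain of ensembles (Claim 3.5.3.1) -/

section Chain

/-- `bb n ≤ A n + Lp n` (trivially, with equality). [folklore] -/
theorem bb_le (n : ℕ) : bb Q n ≤ Q.A.eval n + Q.Lp.eval n + 1 := by unfold bb; omega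

variable (Q)

/-- A polynomial bound for the key length. [folklore] -/
noncomputable def aK : Polynomial ℕ := ((X + 1) * Q.A + 1) * ((X + 1) * (Q.A + Q.Lp + 1) + 1)

/-- **The keyed product ensemble** of a sampler `S`: a fresh key `τ = U_{aK} ↾ K` prepended to the
`t(n)`-fold product of `S`. [folklore] -/
noncomputable def Z (S : List Bool → List Bool) : Ensemble (List Bool) := fun n =>
  (prodEnsemble S Q.A (X + 1) n).bind fun α =>
    (uniformBits ((aK Q).eval n)).map fun s => τF Q (boolPair (unaryEncodeNat n) s) ++ α

/-- **The output ensemble** of a sampler `S`: `Ψ` applied to the keyed product. [folklore] -/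
noncomputable def Out (S : List Bool → List Bool) : Ensemble (List Bool) := fun n =>
  (Z Q S n).map fun w => ΨF Q (boolPair (unaryEncodeNat n) w)

variable {Q}

/-- `K n ≤ aK n`. [folklore] -/
theorem K_le_aK (n : ℕ) : K Q n ≤ (aK Q).eval n := by
  have h1 : kOut Q n ≤ (n + 1) * Q.A.eval n + 1 := by
    unfold kOut t; exact Nat.add_le_add_right (Nat.mul_le_mul_left _ (Q.aT_le_A n)) 1
  have h2 : M Q n + 1 ≤ (n + 1) * (Q.A.eval n + Q.Lp.eval n + 1) + 1 := by
    unfold M t; exact Nat.add_le_add_right (Nat.mul_le_mul_left _ (bb_le n)) 1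
  unfold K
  simp only [aK, eval_mul, eval_add, eval_one, eval_X]
  exact Nat.mul_le_mul h1 h2

/-- Support lengths of the real product: `M n`. [folklore] -/
theorem length_of_mem_support_prodX (hQ : Q.Good) (n : ℕ) (s : List Bool)
    (hs : s ∈ (prodEnsemble Q.SX Q.A (X + 1) n).support) : s.length = M Q n := by
  rw [Q.prodEnsemble_SX hQ, PMF.mem_support_map_iff] at hs
  obtain ⟨R, hR, rfl⟩ := hs
  have hRl := PRGTrunc.length_eq_of_mem_support_uniformBits hR
  simp only [eval_add, eval_X, eval_one] at hRl ⊢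
  exact length_BX hQ hRl

/-- Support lengths of the ideal product: `M n`. [folklore] -/
theorem length_of_mem_support_prodY (hQ : Q.Good) (n : ℕ) (s : List Bool)
    (hs : s ∈ (prodEnsemble Q.SY Q.A (X + 1) n).support) : s.length = M Q n := by
  rw [Q.prodEnsemble_SY hQ, PMF.mem_support_map_iff] at hs
  obtain ⟨R, hR, rfl⟩ := hs
  have hRl := PRGTrunc.length_eq_of_mem_support_uniformBits hR
  simp only [eval_add, eval_X, eval_one] at hRl ⊢
  exact length_BY hQ hRl

/-- Support lengths of a keyed product: `K n + M n`. [folklore] -/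
theorem length_of_mem_support_Z {S : List Bool → List Bool} {n : ℕ}
    (hS : ∀ s ∈ (prodEnsemble S Q.A (X + 1) n).support, s.length = M Q n) :
    ∀ w ∈ (Z Q S n).support, w.length = K Q n + M Q n := by
  intro w hw
  simp only [Z, PMF.mem_support_bind_iff, PMF.mem_support_map_iff] at hw
  obtain ⟨α, hα, s, hs, rfl⟩ := hw
  rw [List.length_append, τF_boolPair, length_unaryEncodeNat, List.length_take,
    PRGTrunc.length_eq_of_mem_support_uniformBits hs, min_eq_left (K_le_aK n), hS α hα]

/-- **Claim 3.5.3.1, keyed products.** [Goldreich 2001, Claim 3.5.3.1 with Prop. 3.5.5] [folklore] -/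
theorem isCompIndistinguishable_Z (hG : Q.G2 ∈ FP) (hQ : Q.Good) (hhid : IsHidingOver Q.g GLHardCore.S₀ Q.r0) :
    IsCompIndistinguishable (Z Q Q.SX) (Z Q Q.SY) := by
  have hM : ∃ P : Polynomial ℕ, ∀ n, M Q n ≤ P.eval n := ⟨(X + 1) * (Q.A + Q.Lp + 1), fun n => by
    unfold M t; simp only [eval_mul, eval_add, eval_X, eval_one]; exact Nat.mul_le_mul_left _ (bb_le n)⟩
  exact (Q.isCompIndistinguishable_prod hG hQ hhid (X + 1)).sampled_append (length_of_mem_support_prodX hQ)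
    (length_of_mem_support_prodY hQ) hM (τF_mem_FP (Q := Q)) (aK Q) (bZ := K Q)
    (fun n s hs => by rw [τF_boolPair, length_unaryEncodeNat, List.length_take, hs, min_eq_left (K_le_aK n)])

/-- **Claim 3.5.3.1, outputs.** [Goldreich 2001, Claim 3.5.3.1] [folklore] -/
theorem isCompIndistinguishable_Out (hG : Q.G2 ∈ FP) (hQ : Q.Good) (hhid : IsHidingOver Q.g GLHardCore.S₀ Q.r0) :
    IsCompIndistinguishable (Out Q Q.SX) (Out Q Q.SY) := by
  have hℓ : ∃ P : Polynomial ℕ, ∀ n, K Q n + M Q n ≤ P.eval n := ⟨aK Q + (X + 1) * (Q.A + Q.Lp + 1), fun n => by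
    have h1 := K_le_aK (Q := Q) n
    have h2 : M Q n ≤ ((X + 1) * (Q.A + Q.Lp + 1) : Polynomial ℕ).eval n := by
      unfold M t; simp only [eval_mul, eval_add, eval_X, eval_one]; exact Nat.mul_le_mul_left _ (bb_le n)
    rw [eval_add]; exact Nat.add_le_add h1 h2⟩
  exact (isCompIndistinguishable_Z hG hQ hhid).map_fp
    (fun n => length_of_mem_support_Z fun s hs => length_of_mem_support_prodX hQ n s hs)
    (fun n => length_of_mem_support_Z fun s hs => length_of_mem_support_prodY hQ n s hs) hℓ (ΨF_mem_FP (Q := Q))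
    (fun n w hw => length_ΨF (by rw [hw]; exact Nat.le_add_right _ _))

/-! ### The laws of the output ensembles -/

/-- **The law of an output ensemble** built on `G(U_L)`. [folklore] -/
theorem out_law (G : List Bool → List Bool) (L n : ℕ) :
    ((((uniformBits L).map G).bind fun α => (uniformBits ((aK Q).eval n)).map fun s =>
        τF Q (boolPair (unaryEncodeNat n) s) ++ α).map fun w => ΨF Q (boolPair (unaryEncodeNat n) w)) =
      (uniformBits (K Q n + L)).map fun s => out Q n (s.take (K Q n)) (G (s.drop (K Q n))) := by
  simp only [τF_boolPair, ΨF_boolPair, length_unaryEncodeNat]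
  rw [keyed_law G L (K_le_aK n), PMF.map_comp]
  refine uniformBits_map_congr fun s hs => ?_
  have hK : (s.take (K Q n)).length = K Q n := by rw [List.length_take, hs, min_eq_left (Nat.le_add_right _ _)]
  simp only [Function.comp_apply]
  rw [List.take_left' hK, List.drop_left' hK]

/-- **The law of the real output ensemble.** [folklore] -/
theorem Out_SX_eq (hQ : Q.Good) (n : ℕ) :
    Out Q Q.SX n = (uniformBits (d Q n)).map fun s => out Q n (s.take (K Q n)) (BX Q n (s.drop (K Q n))) := by
  show (Z Q Q.SX n).map _ = _
  simp only [Z]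
  rw [Q.prodEnsemble_SX hQ]
  simp only [eval_add, eval_X, eval_one]
  exact out_law (BX Q n) _ n

/-- **The law of the ideal output ensemble.** [folklore] -/
theorem Out_SY_eq (hQ : Q.Good) (n : ℕ) :
    Out Q Q.SY n = (uniformBits (K Q n + t n * Q.A.eval n)).map fun s => out Q n (s.take (K Q n)) (BY Q n (s.drop (K Q n))) := by
  show (Z Q Q.SY n).map _ = _
  simp only [Z]
  rw [Q.prodEnsemble_SY hQ]
  simp only [eval_add, eval_X, eval_one]
  exact out_law (BY Q n) _ n

/-- **The generator's output ensemble is the real output ensemble.** [folklore] -/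
theorem levelEnsemble_eq (hQ : Q.Good) : PRGExt.levelEnsemble (d Q) (genF Q) = Out Q Q.SX := by
  funext n
  rw [Out_SX_eq hQ]
  exact uniformBits_map_congr fun s hs => genF_apply hQ hs

end Chain

/-! ### Extraction: the ideal output is statistically close to uniform (collision-probability LHL) -/

section Extract

/-- **The Leftover-Hash step.** At level `n`, the ideal output `h_τ(BY) ‖ τ` — `BY` on uniform coins, with
collision count `#collT`, and `h_τ : {0,1}^M → {0,1}^{kOut}` a uniformly keyed pairwise independent (affine)
hash — is within statistical distance `½·√(2^{kOut} · #collT / 2^{2·t·A})` of `U_{r n}`.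
[Håstad–Impagliazzo–Levin–Luby 1999, Lemma 4.8; Goldreich 2001, Claim 3.5.3.2] [folklore] -/
theorem tvDist_OutY_le (hQ : Q.Good) (n : ℕ) :
    (Out Q Q.SY n).tvDist (uniformBits (r Q n)) ≤
      2⁻¹ * Real.sqrt ((2 : ℝ) ^ kOut Q n * ((collT Q n (t n)).card / ((2 : ℝ) ^ (t n * Q.A.eval n)) ^ 2)) := by
  classical
  set Kn := K Q n with hKn
  set L := t n * Q.A.eval n with hL
  set γ := Fin (kOut Q n) → ZMod 2
  let BYv : List.Vector Bool L → List.Vector Bool (M Q n) := fun R => ⟨BY Q n R.toList, length_BY hQ R.toList_length⟩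
  let e : List.Vector Bool Kn × List.Vector Bool L → List Bool := fun q => q.1.toList ++ q.2.toList
  have he : Function.Injective e := by
    rintro ⟨τ, R⟩ ⟨τ', R'⟩ h
    obtain ⟨h1, h2⟩ := List.append_inj h (by rw [τ.toList_length, τ'.toList_length])
    dsimp only at h1 h2
    rw [List.Vector.toList_injective h1, List.Vector.toList_injective h2]
  let hfam : List.Vector Bool Kn → List.Vector Bool (M Q n) → γ := fun σ x => AffineStr.hashV (M Q n) (kOut Q n) σ.toList x
  let enc : γ × List.Vector Bool Kn → List Bool := fun q => AffineStr.encZ (kOut Q n) q.1 ++ q.2.toList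
  have henc : Function.Injective enc := by
    rintro ⟨v, τ⟩ ⟨v', τ'⟩ h
    obtain ⟨h1, h2⟩ := List.append_inj h (by rw [AffineStr.length_encZ, AffineStr.length_encZ])
    dsimp only at h1 h2
    rw [AffineStr.encZ_injective _ h1, List.Vector.toList_injective h2]
  let g : List.Vector Bool Kn × List.Vector Bool L → γ × List.Vector Bool Kn := fun q => (hfam q.1 (BYv q.2), q.1)
  set Φ : List Bool → List Bool := fun s => out Q n (s.take Kn) (BY Q n (s.drop Kn)) with hΦ
  have hlaw : Out Q Q.SY n = (condUniform (allStr (Kn + L))).map Φ := by rw [Out_SY_eq hQ, condUniform_allStr]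
  have hne : (allStr (Kn + L)).Nonempty := ⟨List.replicate (Kn + L) false, mem_allStr.2 (by simp)⟩
  have hlen : ∀ s ∈ allStr (Kn + L), (Φ s).length = r Q n := fun s hs => by
    rw [hΦ]; simp only
    rw [length_out, List.length_take, mem_allStr.1 hs, min_eq_left (Nat.le_add_right _ _), r]
  rw [hlaw, tvDist_condUniform_map_eq_sdUnif hne, sdUnif_eq_distUnif _ _ hlen]
  have hW : (Finset.univ : Finset (List.Vector Bool Kn × List.Vector Bool L)).image e = allStr (Kn + L) :=
    image_eq_allStr he.injOn (fun q _ => by simp [e]) (by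
      rw [Finset.card_univ, Fintype.card_prod, card_vector, card_vector, Fintype.card_bool, pow_add])
  rw [← hW, LeftoverHash.distUnif_image he.injOn]
  have hfac : Φ ∘ e = enc ∘ g := by
    funext q
    obtain ⟨τ, R⟩ := q
    simp only [Function.comp_apply, e, enc, g, hΦ]
    rw [List.take_left' τ.toList_length, List.drop_left' τ.toList_length, out]
    congr 1
    exact AffineStr.hashStr_toList (M Q n) (kOut Q n) τ.toList (BYv R)
  have hT : (Finset.univ : Finset (γ × List.Vector Bool Kn)).image enc = allStr (r Q n) :=
    image_eq_allStr henc.injOn (fun q _ => by simp [enc, AffineStr.length_encZ, r, hKn]) (by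
      rw [Finset.card_univ, Fintype.card_prod, Fintype.card_fun, ZMod.card, Fintype.card_fin, card_vector, Fintype.card_bool,
        r, pow_add])
  rw [hfac, ← hT, LeftoverHash.distUnif_comp_of_injective _ g henc]
  have hg : g = Prod.swap ∘ (LeftoverHash.keyed fun k w => hfam k (BYv w)) := by
    funext q; simp [g, LeftoverHash.keyed]
  have hswap : (Finset.univ : Finset (γ × List.Vector Bool Kn)) =
      (Finset.univ : Finset (List.Vector Bool Kn × γ)).image Prod.swap :=
    (Finset.image_univ_of_surjective Prod.swap_surjective).symm
  rw [hg, hswap, LeftoverHash.distUnif_comp_of_injective _ _ Prod.swap_injective, ← Finset.univ_product_univ,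
    ← Finset.univ_product_univ]
  -- the Leftover Hash Lemma, collision-probability form
  have hPI : LeftoverHash.IsPairwiseIndep (Finset.univ : Finset (List.Vector Bool Kn)) hfam Finset.univ :=
    AffineStr.isPairwiseIndep_hashV (le_of_eq rfl) _
  refine (LeftoverHash.leftoverHash_collProb Finset.univ_nonempty hPI Finset.univ_nonempty (x := BYv)
    (fun _ _ => Finset.mem_univ _)).trans ?_
  refine mul_le_mul_of_nonneg_left (Real.sqrt_le_sqrt ?_) (by norm_num)
  rw [Fintype.card_fun, ZMod.card, Fintype.card_fin]
  push_cast
  refine mul_le_mul_of_nonneg_left ?_ (by positivity)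
  -- `collProb univ BYv ≤ #collT / |{0,1}^L|²`
  unfold LeftoverHash.collProb
  rw [Finset.card_univ, card_vector, Fintype.card_bool]
  push_cast
  refine div_le_div_of_nonneg_right ?_ (by positivity)
  have hsub : ((Finset.univ ×ˢ Finset.univ).filter fun p : List.Vector Bool L × List.Vector Bool L => BYv p.1 = BYv p.2).card ≤
      (collT Q n (t n)).card := by
    refine Finset.card_le_card_of_injOn (fun p => (p.1.toList, p.2.toList)) (fun p hp => ?_) ?_
    · rw [Finset.mem_coe, Finset.mem_filter] at hp
      simp only [collT, Finset.coe_filter, Set.mem_setOf_eq, Finset.mem_product, mem_allStr, List.Vector.toList_length]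
      have := congrArg List.Vector.toList hp.2
      exact ⟨⟨hL, hL⟩, this⟩
    · rintro ⟨R, R'⟩ _ ⟨Z, Z'⟩ _ h
      simp only [Prod.mk.injEq] at h
      exact Prod.ext (List.Vector.toList_injective h.1) (List.Vector.toList_injective h.2)
  exact_mod_cast hsub

/-- **The exponent**: `2^{kOut}·#collT/2^{2tA} ≤ 2^{-n}` for `n ≥ 2^{c₀+1}` under the collision bound
(`t·A − kOut = t·k − 1`, `k = ⌊log₂ n⌋ ≥ c₀ + 1`, `t = n + 1`). [Goldreich 2001, §3.5.2 ("only logarithmic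
loss of entropy occurs, and such a loss can be compensated")] [folklore] -/
theorem ratio_le (hQ : Q.Good) {c0 : ℕ} (hcoll : CollBound Q c0) {n : ℕ} (hn : 2 ^ (c0 + 1) ≤ n) :
    (2 : ℝ) ^ kOut Q n * ((collT Q n (t n)).card / ((2 : ℝ) ^ (t n * Q.A.eval n)) ^ 2) ≤ (1 / 2 : ℝ) ^ n := by
  have hk : c0 + 1 ≤ kL n := Nat.le_log_of_pow_le (by norm_num) hn
  have hkn := kL_le n
  have hkA : kL n ≤ Q.A.eval n := by rw [HCHide.Data.A_eval]; nlinarith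
  have h1 : t n * Q.A.eval n = t n * (Q.A.eval n - kL n) + t n * kL n := by rw [← Nat.mul_add, Nat.sub_add_cancel hkA]
  have h2 : t n * (c0 + 1) ≤ t n * kL n := Nat.mul_le_mul_left _ hk
  obtain ⟨c, hc⟩ : ∃ c, t n * Q.A.eval n = kOut Q n + (c0 * t n + n + c) := by
    refine ⟨t n * kL n - 1 - n - c0 * t n, ?_⟩
    unfold kOut HCHide.Data.aT
    unfold t at *
    rw [Nat.mul_add, Nat.mul_one] at h2
    have : (n + 1) * c0 = c0 * (n + 1) := Nat.mul_comm _ _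
    omega
  have hC : ((collT Q n (t n)).card : ℝ) ≤ (2 : ℝ) ^ (c0 * t n) * (2 : ℝ) ^ (t n * Q.A.eval n) := by
    have := card_collT_le hQ hcoll n (t n)
    rw [← pow_mul] at this
    exact_mod_cast this
  have hpos : (0 : ℝ) < (2 : ℝ) ^ (t n * Q.A.eval n) := by positivity
  calc (2 : ℝ) ^ kOut Q n * ((collT Q n (t n)).card / ((2 : ℝ) ^ (t n * Q.A.eval n)) ^ 2)
      ≤ (2 : ℝ) ^ kOut Q n * ((2 : ℝ) ^ (c0 * t n) * (2 : ℝ) ^ (t n * Q.A.eval n) / ((2 : ℝ) ^ (t n * Q.A.eval n)) ^ 2) :=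
        mul_le_mul_of_nonneg_left (div_le_div_of_nonneg_right hC (by positivity)) (by positivity)
    _ = (2 : ℝ) ^ kOut Q n * (2 : ℝ) ^ (c0 * t n) / (2 : ℝ) ^ (t n * Q.A.eval n) := by field_simp
    _ = 1 / (2 : ℝ) ^ n / (2 : ℝ) ^ c := by rw [hc, pow_add, pow_add, pow_add]; field_simp
    _ ≤ 1 / (2 : ℝ) ^ n := div_le_self (by positivity) (one_le_pow₀ (by norm_num))
    _ = (1 / 2 : ℝ) ^ n := by rw [one_div_pow]

/-- **Claim 3.5.3.2**: the ideal output ensemble is statistically close to uniform. [Goldreich 2001,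
Claim 3.5.3.2 (PDF pp. 171–172), collision-probability form] [folklore] -/
theorem isStatisticallyClose_OutY (hQ : Q.Good) {c0 : ℕ} (hcoll : CollBound Q c0) :
    IsStatisticallyClose (Out Q Q.SY) (uniformEnsemble (r Q)) := by
  set c := Real.sqrt (1 / 2) with hc
  have hc0 : 0 ≤ c := Real.sqrt_nonneg _
  have hc1 : c < 1 := (Real.sqrt_lt' one_pos).2 (by norm_num)
  have hsq : ∀ n : ℕ, Real.sqrt ((1 / 2 : ℝ) ^ n) = c ^ n := fun n => by
    rw [show (1 / 2 : ℝ) ^ n = (c ^ n) ^ 2 by rw [← pow_mul, mul_comm, pow_mul, Real.sq_sqrt (by norm_num)],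
      Real.sqrt_sq (pow_nonneg hc0 n)]
  have h0 : SuperpolynomialDecay atTop (fun n : ℕ => (n : ℝ)) (fun n => 2⁻¹ * c ^ n) := by
    intro m
    have h := (tendsto_pow_const_mul_const_pow_of_abs_lt_one m (r := c) (by rw [abs_of_nonneg hc0]; exact hc1)).const_mul 2⁻¹
    rw [mul_zero] at h
    exact h.congr fun n => by ring
  refine h0.trans_eventually_abs_le ?_
  filter_upwards [eventually_ge_atTop (2 ^ (c0 + 1))] with n hn
  simp only [Function.comp_apply]
  rw [abs_of_nonneg (PMF.tvDist_nonneg _ _), abs_of_nonneg (by positivity)]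
  calc (Out Q Q.SY n).tvDist (uniformEnsemble (r Q) n)
      ≤ 2⁻¹ * Real.sqrt ((2 : ℝ) ^ kOut Q n * ((collT Q n (t n)).card / ((2 : ℝ) ^ (t n * Q.A.eval n)) ^ 2)) := tvDist_OutY_le hQ n
    _ ≤ 2⁻¹ * Real.sqrt ((1 / 2 : ℝ) ^ n) := mul_le_mul_of_nonneg_left (Real.sqrt_le_sqrt (ratio_le hQ hcoll hn)) (by norm_num)
    _ = 2⁻¹ * c ^ n := by rw [hsq]

end Extract

/-! ### The theorem -/

section Main

/-- **The output of the generator is pseudorandom.** [Goldreich 2001, Prop. 3.5.3 (collision form)] [folklore] -/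
theorem isPseudorandom_Out (hG : Q.G2 ∈ FP) (hQ : Q.Good) (hhid : IsHidingOver Q.g GLHardCore.S₀ Q.r0) {c0 : ℕ}
    (hcoll : CollBound Q c0) : IsPseudorandom (Out Q Q.SX) (r Q) :=
  IsCompIndistinguishable.trans_holds (isCompIndistinguishable_Out hG hQ hhid)
    (IsStatisticallyClose.isCompIndistinguishable_holds (isStatisticallyClose_OutY hQ hcoll))

/-- **The seed lengths `d n` are strictly increasing.** [folklore] -/
theorem strictMono_d : StrictMono (d Q) := by
  refine strictMono_nat_of_lt_succ fun n => ?_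
  have hk := kL_le n
  have hlog := kL_succ_le n
  have hr0 : Q.r0 n ≤ Q.r0 (n + 1) := TM2Iter.eval_mono Q.R0 (Nat.le_succ n)
  have hLp : Q.Lp.eval n ≤ Q.Lp.eval (n + 1) := TM2Iter.eval_mono Q.Lp (Nat.le_succ n)
  have hQn : n ≤ n * (n + 2) := Nat.le_mul_of_pos_right n (by omega)
  have hsq : (n + 1) * (n + 1 + 2) = n * (n + 2) + 2 * n + 3 := by ring
  have haT : Q.aT n + 1 ≤ Q.aT (n + 1) := by
    unfold HCHide.Data.aT; rw [HCHide.Data.A_eval, HCHide.Data.A_eval, hsq]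
    generalize n * (n + 2) = P at *
    omega
  have haT1 : 1 ≤ Q.aT (n + 1) := by omega
  have hb : bb Q n ≤ bb Q (n + 1) := by
    unfold bb
    rw [HCHide.Data.A_eval, HCHide.Data.A_eval, hsq]
    generalize n * (n + 2) = P at hQn ⊢
    omega
  have ht : t n * Q.aT n < t (n + 1) * Q.aT (n + 1) := by
    unfold t
    calc (n + 1) * Q.aT n ≤ (n + 1) * Q.aT (n + 1) := Nat.mul_le_mul_left _ (by omega)
      _ < (n + 1 + 1) * Q.aT (n + 1) := by nlinarith
  have hkOut : kOut Q n < kOut Q (n + 1) := by unfold kOut; omega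
  have hM : M Q n ≤ M Q (n + 1) := Nat.mul_le_mul (by unfold t; omega) hb
  have hK : K Q n ≤ K Q (n + 1) := Nat.mul_le_mul hkOut.le (by omega)
  unfold d; omega

/-- **The generator data give a pseudorandom generator** (via `PRGExist_of_levels`). [folklore] -/
theorem prgExist (hG : Q.G2 ∈ FP) (hQ : Q.Good) (hhid : IsHidingOver Q.g GLHardCore.S₀ Q.r0) {c0 : ℕ} (hcoll : CollBound Q c0) :
    PRGExist :=
  PRGExist_of_levels (strictMono_d (Q := Q)) dF_mem_FP (genF_mem_FP hG) (fun _ _ hs => length_genF hQ hs)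
    (fun n => (r_eq Q n).ge) (by rw [levelEnsemble_eq hQ]; exact isPseudorandom_Out hG hQ hhid hcoll)

end Main

end HidePRG

/-- **Pseudorandom generators from hiding randomized functions with few collisions** (the engine of
Goldreich 2001, §3.5.1–3.5.2). Let `g(x ‖ ρ)` (`|ρ| = R0(|x|)`) be computed on `⟨1ⁿ, x ‖ ρ⟩` by a
polynomial-time program `G2`, with outputs of a fixed length `L(n) ≤ Lp(n)` on the seeds of level `n`
(`Q.Good` for the data `Q = ⟨g, G2, R0, Lp, L⟩`). If `g` is `S₀`-hiding (no PPT algorithm recovers `x` from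
`(1ⁿ, g(x ‖ ρ))` but with negligible probability) and has few collisions on every level
(`#{(v, v') : g v = g v'} ≤ 2^{c₀}·2^{|v|}`), then pseudorandom generators exist. The case `R0 = 0`, `c₀ = 0`
is Thm. 3.5.6 (1-1 one-way functions, `PRGExist_of_isOneWay_injOn`); `g(x, h) = (f(x), h(x), h)` for a
regular one-way `f` (Prop. 3.5.9) gives Thm. 3.5.11. [cite: Goldreich2001, §3.5.1.3 with Props. 3.5.3, 3.5.5 and §3.5.2 ("Applying Proposition 3.5.9", PDF p. 180)] -/
theorem HidePRG.PRGExist_of_hiding (Q : HCHide.Data) (hG : Q.G2 ∈ FP) (hQ : Q.Good)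
    (hhid : IsHidingOver Q.g GLHardCore.S₀ Q.r0) {c0 : ℕ} (hcoll : HidePRG.CollBound Q c0) : PRGExist :=
  HidePRG.prgExist hG hQ hhid hcoll

end Literature.Computability.Cryptography
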